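import Mathlib
import HarnessLib
import Summits.NavierStokesRegularity.NavierStokesRegularity.Theses.RootDecompBaireThreshold
import Literature.Analysis.FluidPDE.GIPGlobalStabilityProofs
import Literature.Analysis.FluidPDE.KatoViscosityScaling
import Literature.Barriers.NavierStokesRegularity.ContinuityMethodClosedness
import Summits.NavierStokesRegularity.NavierStokesRegularity.Theorems.HeredityFromTwo.Negative.KatoLargeData

/-!
# `RayGlobalOpen` — lemma B1 of the Baire dichotomy (route `RootDecompBaireThreshold`, item
stmt-NavierStokesRegularity-28468, aside)

«Kato-global up to amplitude `A`» is a Schwartz-open condition on Clay data: if `a • u₀` has a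
global Kato solution for every `0 < a ≤ A`, then so does `a • w` for every Clay datum `w` that is
`ε`-close to `u₀` in the weighted `C²`-seminorm `sup_x (1 + ‖x‖)² ‖Dᵐ(w - u₀)(x)‖`, `m ≤ 2`.

Proof (as announced in the item's docstring): the set `G_ν ⊆ L³_σ` of data with a global Kato
solution is open (Gallagher–Iftimie–Planchon 2003, Thm. 0.1 — tree
`GIP2003_L3_stability_holds.exists_ball_hasGlobalKatoSolution`) and contains `0` (Kato 1984 —
tree `hasGlobalKatoSolution_zero`); the segment `{a • u₀ : a ∈ [0, A]}` is compact, so finitely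
many stability balls cover it with a uniform `L³` margin; and the weighted sup bound with `k = 2`
controls `‖w - u₀‖_{L³}` because `(1 + ‖x‖)⁻² ∈ L³(ℝ³)`. Clay data are weakly divergence-free
`L³` fields by the tree lemmas `PalasekTowerClayBridge.memLp_three_of_hasRapidSpatialDecay` /
`isWeaklyDivFree_of_contDiff_of_isDivFree`.
-/

set_option linter.dupNamespace false

noncomputable section

open MeasureTheory Set Filter Topology
open scoped ENNReal

namespace Summit.NavierStokesRegularity.NavierStokesRegularity.Theorems.RayGlobalOpen

open Literature.Analysis.FluidPDE

/-- The weight `x ↦ (1 + ‖x‖)⁻²` on `ℝ³`. -/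
private theorem weight_memL3 :
    eLpNorm (fun x : EuclideanSpace ℝ (Fin 3) => (1 + ‖x‖) ^ (-(2 : ℝ))) 3 volume < ⊤ := by
  rw [eLpNorm_lt_top_iff_lintegral_rpow_enorm_lt_top (by norm_num) (by norm_num)]
  have hint : Integrable (fun x : EuclideanSpace ℝ (Fin 3) => (1 + ‖x‖) ^ (-(6 : ℝ))) volume :=
    integrable_one_add_norm (by simp; norm_num)
  refine lt_of_le_of_lt (le_of_eq (lintegral_congr fun x => ?_)) hint.2
  have h1 : 0 < 1 + ‖x‖ := by positivity
  have h2 : 0 ≤ (1 + ‖x‖) ^ (-(2 : ℝ)) := Real.rpow_nonneg h1.le _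
  rw [ENNReal.toReal_ofNat, Real.enorm_eq_ofReal h2, Real.enorm_eq_ofReal (Real.rpow_nonneg h1.le _),
    ENNReal.ofReal_rpow_of_nonneg h2 (by norm_num), ← Real.rpow_mul h1.le]
  norm_num

/-- **Weighted sup bound ⟹ `L³` bound**: if `(1 + ‖x‖)² ‖f x‖ ≤ ε` for all `x`, then
`‖f‖_{L³} ≤ ε ‖(1 + ‖·‖)⁻²‖_{L³}`. [folklore] -/
theorem eLpNorm_three_le_of_weighted_bound {f : EuclideanSpace ℝ (Fin 3) → EuclideanSpace ℝ (Fin 3)}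
    {ε : ℝ} (hb : ∀ x, (1 + ‖x‖) ^ (2 : ℕ) * ‖f x‖ ≤ ε) :
    eLpNorm f 3 volume ≤ ENNReal.ofReal ε *
      eLpNorm (fun x : EuclideanSpace ℝ (Fin 3) => (1 + ‖x‖) ^ (-(2 : ℝ))) 3 volume := by
  have hε : 0 ≤ ε := le_trans (by positivity) (hb 0)
  have hpt : ∀ x, ‖f x‖ ≤ ‖(ε • fun y : EuclideanSpace ℝ (Fin 3) => (1 + ‖y‖) ^ (-(2 : ℝ))) x‖ := by
    intro x
    have h1 : 0 < 1 + ‖x‖ := by positivity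
    have h2 : 0 < (1 + ‖x‖) ^ (2 : ℕ) := by positivity
    rw [Pi.smul_apply, smul_eq_mul, norm_mul, Real.norm_of_nonneg hε,
      Real.norm_of_nonneg (Real.rpow_nonneg h1.le _), Real.rpow_neg h1.le, Real.rpow_two,
      ← div_eq_mul_inv, le_div_iff₀ h2, mul_comm]
    exact hb x
  calc eLpNorm f 3 volume
      ≤ eLpNorm (ε • fun y : EuclideanSpace ℝ (Fin 3) => (1 + ‖y‖) ^ (-(2 : ℝ))) 3 volume :=
        eLpNorm_mono hpt
    _ = ENNReal.ofReal ε * eLpNorm (fun x : EuclideanSpace ℝ (Fin 3) => (1 + ‖x‖) ^ (-(2 : ℝ))) 3 volume := by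
        rw [eLpNorm_const_smul, Real.enorm_eq_ofReal hε]

/-- **Every point of the closed segment `[0, A] • u₀` is Kato-global** when the open-closed part
`(0, A]` is (hypothesis) — the endpoint `0 • u₀ = 0` by Kato's small-data theorem.
[cite: Kato1984MathZ, Thm. 2 (p. 472)] -/
theorem hasGlobalKatoSolution_segment {ν A : ℝ} (hν : 0 < ν)
    {u₀ : EuclideanSpace ℝ (Fin 3) → EuclideanSpace ℝ (Fin 3)}
    (hray : ∀ a : ℝ, 0 < a → a ≤ A → HasGlobalKatoSolution ν (a • u₀)) :
    ∀ a ∈ Icc 0 A, HasGlobalKatoSolution ν (a • u₀) := by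
  intro a ha
  rcases ha.1.eq_or_lt with h0 | hpos
  · rw [← h0, zero_smul]
    exact Literature.Barriers.NavierStokesRegularity.hasGlobalKatoSolution_zero hν
  · exact hray a hpos ha.2

/-- **Uniform `L³` stability margin along the compact segment** `[0, A] • u₀` (GIP openness +
compactness): there is `δ > 0` such that every weakly divergence-free `v₀ ∈ L³` within `L³`-distance
`δ` of some `s • u₀`, `s ∈ [0, A]`, has a global Kato solution.
[cite: GallagherIftimiePlanchon2003, Thm. 0.1 (p. 1389)] -/
theorem exists_uniform_margin {ν A : ℝ} (hν : 0 < ν)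
    {u₀ : EuclideanSpace ℝ (Fin 3) → EuclideanSpace ℝ (Fin 3)} (hu3 : MemLp u₀ 3 volume)
    (hwd : IsWeaklyDivFree u₀) (hall : ∀ a ∈ Icc 0 A, HasGlobalKatoSolution ν (a • u₀)) :
    ∃ δ : ℝ, 0 < δ ∧ ∀ s ∈ Icc 0 A, ∀ v₀ : EuclideanSpace ℝ (Fin 3) → EuclideanSpace ℝ (Fin 3),
      MemLp v₀ 3 volume → IsWeaklyDivFree v₀ →
      eLpNorm (s • u₀ - v₀) 3 volume ≤ ENNReal.ofReal δ → HasGlobalKatoSolution ν v₀ := by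
  -- stability radius at each point of the segment
  have hex : ∀ a : ℝ, a ∈ Icc 0 A → ∃ e : ℝ, 0 < e ∧
      ∀ v₀ : EuclideanSpace ℝ (Fin 3) → EuclideanSpace ℝ (Fin 3), MemLp v₀ 3 volume →
        IsWeaklyDivFree v₀ → eLpNorm (a • u₀ - v₀) 3 volume < ENNReal.ofReal e →
        HasGlobalKatoSolution ν v₀ := fun a ha =>
    GIP2003_L3_stability_holds.exists_ball_hasGlobalKatoSolution hν (hu3.const_smul a)
      (hwd.const_smul a) (hall a ha)
  choose! e he hball using hex
  -- the `L³` norm of `u₀` as a real number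
  set N : ℝ := (eLpNorm u₀ 3 volume).toReal with hN
  have hN0 : 0 ≤ N := ENNReal.toReal_nonneg
  have hNe : eLpNorm u₀ 3 volume = ENNReal.ofReal N := by
    rw [hN, ENNReal.ofReal_toReal hu3.eLpNorm_ne_top]
  -- finite subcover of the compact parameter segment by the parameter balls
  set U : Icc 0 A → Set ℝ := fun a => Metric.ball (a : ℝ) (e a / (2 * (N + 1))) with hU
  have hUo : ∀ a, IsOpen (U a) := fun a => Metric.isOpen_ball
  have hcov : Icc 0 A ⊆ ⋃ a, U a := by
    intro x hx
    refine mem_iUnion.2 ⟨⟨x, hx⟩, ?_⟩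
    exact Metric.mem_ball_self (div_pos (he x hx) (by linarith))
  obtain ⟨t, ht⟩ := isCompact_Icc.elim_finite_subcover U hUo hcov
  -- a positive lower bound of the finitely many radii
  obtain ⟨δ₀, hδ₀, hδ₀le⟩ : ∃ δ₀ : ℝ, 0 < δ₀ ∧ ∀ a ∈ t, δ₀ ≤ e a := by
    by_cases htn : t.Nonempty
    · obtain ⟨a₀, ha₀, hmin⟩ := t.exists_min_image (fun a => e a) htn
      exact ⟨e a₀, he a₀ a₀.2, fun a ha => hmin a ha⟩
    · exact ⟨1, one_pos, fun a ha => absurd ⟨a, ha⟩ htn⟩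
  refine ⟨δ₀ / 2, by linarith, fun s hs v₀ hv3 hvd hclose => ?_⟩
  -- `s` lies in the parameter ball of some `a ∈ t`
  obtain ⟨a, hat, hsa⟩ : ∃ a ∈ t, s ∈ U a := by
    simpa only [mem_iUnion, exists_prop] using ht hs
  have hea : 0 < e a := he a a.2
  have hsa' : |(a : ℝ) - s| < e a / (2 * (N + 1)) := by
    rw [abs_sub_comm]; simpa [hU, Real.dist_eq] using hsa
  -- `‖a • u₀ - s • u₀‖₃ < e a / 2`
  have h1 : eLpNorm ((a : ℝ) • u₀ - s • u₀) 3 volume < ENNReal.ofReal (e a / 2) := by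
    rw [← sub_smul, eLpNorm_const_smul, hNe, ← ofReal_norm, Real.norm_eq_abs,
      ← ENNReal.ofReal_mul (abs_nonneg _)]
    refine (ENNReal.ofReal_lt_ofReal_iff (by linarith)).2 ?_
    calc |(a : ℝ) - s| * N ≤ e a / (2 * (N + 1)) * N := mul_le_mul_of_nonneg_right hsa'.le hN0
      _ < e a / 2 := by
          rw [div_mul_eq_mul_div, div_lt_div_iff₀ (by positivity) (by norm_num)]
          nlinarith
  -- `‖s • u₀ - v₀‖₃ ≤ δ₀ / 2 ≤ e a / 2`
  have h2 : eLpNorm (s • u₀ - v₀) 3 volume ≤ ENNReal.ofReal (e a / 2) :=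
    hclose.trans (ENNReal.ofReal_le_ofReal (by linarith [hδ₀le a hat]))
  have h2fin : eLpNorm (s • u₀ - v₀) 3 volume ≠ ⊤ := ((hu3.const_smul s).sub hv3).eLpNorm_ne_top
  -- triangle inequality
  refine hball a a.2 v₀ hv3 hvd ?_
  have htri : eLpNorm ((a : ℝ) • u₀ - v₀) 3 volume ≤
      eLpNorm ((a : ℝ) • u₀ - s • u₀) 3 volume + eLpNorm (s • u₀ - v₀) 3 volume := by
    have heq : (a : ℝ) • u₀ - v₀ = ((a : ℝ) • u₀ - s • u₀) + (s • u₀ - v₀) := by abel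
    rw [heq]
    exact eLpNorm_add_le (((hu3.const_smul _).sub (hu3.const_smul s)).1)
      (((hu3.const_smul s).sub hv3).1) (by norm_num)
  refine htri.trans_lt ?_
  calc eLpNorm ((a : ℝ) • u₀ - s • u₀) 3 volume + eLpNorm (s • u₀ - v₀) 3 volume
      < ENNReal.ofReal (e a / 2) + ENNReal.ofReal (e a / 2) :=
        ENNReal.add_lt_add_of_lt_of_le h2fin h1 h2
    _ = ENNReal.ofReal (e a) := by
        rw [← ENNReal.ofReal_add (by linarith) (by linarith)]; ring_nf

/-- **`RayGlobalOpen`** (lemma B1 of the Baire dichotomy): «Kato-global up to amplitude `A`» is a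
Schwartz-open condition on Clay data. [cite: GallagherIftimiePlanchon2003, Thm. 0.1 (p. 1389)] -/
theorem rayGlobalOpen_proof : Theses.RootDecompBaireThreshold.RayGlobalOpen := by
  intro ν hν A u₀ hu₀ hray
  obtain ⟨hsm, hdiv, hdec⟩ := hu₀
  have hu3 : MemLp u₀ 3 volume := Summit.NavierStokesRegularity.FluidComputer.PalasekTowerClayBridge.memLp_three_of_hasRapidSpatialDecay
      hsm.continuous hdec
  have hwd : IsWeaklyDivFree u₀ := Summit.NavierStokesRegularity.FluidComputer.PalasekTowerClayBridge.isWeaklyDivFree_of_contDiff_of_isDivFree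
      hsm hdiv
  obtain ⟨δ, hδ, hmargin⟩ :=
    exists_uniform_margin hν hu3 hwd (hasGlobalKatoSolution_segment hν hray)
  -- the `L³` norm of the weight, as a real number
  set J : ℝ := (eLpNorm (fun x : EuclideanSpace ℝ (Fin 3) => (1 + ‖x‖) ^ (-(2 : ℝ))) 3 volume).toReal
    with hJ
  have hJ0 : 0 ≤ J := ENNReal.toReal_nonneg
  have hJe : eLpNorm (fun x : EuclideanSpace ℝ (Fin 3) => (1 + ‖x‖) ^ (-(2 : ℝ))) 3 volume =
      ENNReal.ofReal J := by
    rw [hJ, ENNReal.ofReal_toReal weight_memL3.ne]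
  -- the Schwartz radius
  set ε : ℝ := δ / ((|A| + 1) * (J + 1)) with hε
  have hApos : 0 < |A| + 1 := by positivity
  have hεpos : 0 < ε := div_pos hδ (by positivity)
  refine ⟨2, ε, hεpos, fun w hw hclose a ha haA => ?_⟩
  obtain ⟨hwsm, hwdiv, hwdec⟩ := hw
  have hw3 : MemLp w 3 volume := Summit.NavierStokesRegularity.FluidComputer.PalasekTowerClayBridge.memLp_three_of_hasRapidSpatialDecay
      hwsm.continuous hwdec
  have hwwd : IsWeaklyDivFree w := Summit.NavierStokesRegularity.FluidComputer.PalasekTowerClayBridge.isWeaklyDivFree_of_contDiff_of_isDivFree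
      hwsm hwdiv
  -- `‖w - u₀‖₃ ≤ ε J`
  have hL3 : eLpNorm (w - u₀) 3 volume ≤ ENNReal.ofReal (ε * J) := by
    have hb : ∀ x, (1 + ‖x‖) ^ (2 : ℕ) * ‖(w - u₀) x‖ ≤ ε := fun x => by
      simpa [norm_iteratedFDeriv_zero] using hclose 0 (by norm_num) x
    refine (eLpNorm_three_le_of_weighted_bound hb).trans ?_
    rw [hJe, ← ENNReal.ofReal_mul hεpos.le]
  have hA : 0 < A := lt_of_lt_of_le ha haA
  refine hmargin a ⟨ha.le, haA⟩ (a • w) (hw3.const_smul a) (hwwd.const_smul a) ?_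
  -- `‖a • u₀ - a • w‖₃ = a ‖u₀ - w‖₃ ≤ A ε J ≤ δ`
  rw [← smul_sub, eLpNorm_const_smul, Real.enorm_eq_ofReal ha.le, eLpNorm_sub_comm]
  refine (show ENNReal.ofReal a * eLpNorm (w - u₀) 3 volume ≤
      ENNReal.ofReal a * ENNReal.ofReal (ε * J) by gcongr).trans ?_
  rw [← ENNReal.ofReal_mul ha.le]
  refine ENNReal.ofReal_le_ofReal ?_
  have hAabs : a ≤ |A| + 1 := haA.trans ((le_abs_self A).trans (by linarith))
  calc a * (ε * J) ≤ (|A| + 1) * (ε * J) :=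
        mul_le_mul_of_nonneg_right hAabs (mul_nonneg hεpos.le hJ0)
    _ = δ * (J / (J + 1)) := by
        rw [hε]; field_simp
    _ ≤ δ * 1 := mul_le_mul_of_nonneg_left ((div_le_one (by positivity)).2 (by linarith)) hδ.le
    _ = δ := mul_one δ

end Summit.NavierStokesRegularity.NavierStokesRegularity.Theorems.RayGlobalOpen

end
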